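import Literature.NumberTheory.EllipticCurves.ModularCurve
import Literature.NumberTheory.EllipticCurves.Isogeny
import Literature.NumberTheory.EllipticCurves.AnalyticRank
import Literature.NumberTheory.DiophantineGeometry.Conductor
import HarnessLib

/-!
# Elliptic curves of odd modular degree (Calegari–Emerton 2009)

[importance: standard (the printed constraint on elliptic curves `E/ℚ` whose modular degree
`m_E = min deg(X₀(N) → E)` is odd; vendored as a named fact at the request of cell `bsd-f2-manin`
(planner-of-record `bsd-f2-manin-imc`, ask T-imc-6: the «print floor at 2» — on the whole `4 ∣ N` band,
`E[2]` irreducible forces `2 ∣ deg φ₀`), consumers: the cell's rows E-imc-10′ / E-an-4a and its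
CANDIDATES §A′ print baseline)]

Calegari–Emerton, *Elliptic curves of odd modular degree*, Israel J. Math. 169 (2009), Theorem 1:
if `E/ℚ` is an elliptic curve of odd modular degree then (i) the conductor `N` of `E` is divisible by
at most two odd primes, (ii) `E` is of even analytic rank, and (iii) either (a) `E` has a rational point
of order `2` (equivalently, admits a rational `2`-isogeny), or (b) `E` has prime conductor,
supersingular reduction at `2`, and `ℚ(E[2])` is totally complex (equivalently, `E(ℝ)` is connected),
or (c) `E` has complex multiplication and `N ∈ {27, 32, 49, 243}`.

Rendering over the tree's vocabulary (statement only; the proof — a Gorenstein/multiplicity-one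
analysis of the Hecke algebra at `2` — is not in the tree): the modular degree of `E = W` is the minimal
`modularDegree` of a `ModularParametrizationData W N` at the conductor level `N = W.conductorNorm ℤ`;
«rational point of order 2» is `∃ P : W.toAffine.Point, addOrderOf P = 2`; with `N` prime, `E` has good
reduction at `2` and «supersingular at 2» is `a₂(E)` even (`Even (W.LFunction 2)`); «`E(ℝ)` connected»
is `W.Δ < 0`; complex multiplication is the tree's geometric `WeierstrassCurve.HasCM`.

## References
* [CalegariEmerton2008] F. Calegari, M. Emerton, Elliptic curves of odd modular degree, Israel J. Math.
  169 (2009), 417–444, Theorem 1 (arXiv:math/0503359, p. 2). doi:10.1007/s11856-009-0017-x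
-/

noncomputable section

open scoped MatrixGroups ModularForm

open CongruenceSubgroup WeierstrassCurve
  Literature.NumberTheory.EllipticCurves Literature.NumberTheory.EllipticCurves.ModularForms

namespace Literature.NumberTheory.EllipticCurves

/-- **Calegari–Emerton 2009, Theorem 1 (elliptic curves of odd modular degree).** If `E/ℚ` is an
elliptic curve whose modular degree `m_E` (the minimal degree of a modular parametrisation
`X₀(N) → E`, `N` the conductor) is odd, then: the conductor `N` is divisible by at most two odd primes;
`E` is of even analytic rank; and either (a) `E` has a rational point of order `2`, or (b) `N` is prime,
`E` has supersingular reduction at `2` (`a₂(E)` even) and `E(ℝ)` is connected (`Δ < 0`), or (c) `E` has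
complex multiplication and `N ∈ {27, 32, 49, 243}`. Here `E` is the Weierstrass curve `W`, its modular
degree is rendered as the minimal `modularDegree` among the `X₀(N)`-parametrisation data of `W` at level
`N = W.conductorNorm ℤ`, witnessed by the datum `D`.
[cite: CalegariEmerton2008, Theorem 1 (arXiv:math/0503359, p. 2)] -/
def calegariEmerton_oddModularDegree : Prop :=
  ∀ (W : WeierstrassCurve ℚ) [W.IsElliptic] [NeZero (W.conductorNorm ℤ)]
    (D : ModularParametrizationData W (W.conductorNorm ℤ)),
    (∀ D' : ModularParametrizationData W (W.conductorNorm ℤ), D.modularDegree ≤ D'.modularDegree) →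
    Odd D.modularDegree →
    (((W.conductorNorm ℤ).primeFactors.filter (fun q => q ≠ 2)).card ≤ 2) ∧
    Even W.analyticRank ∧
    ((∃ P : W.toAffine.Point, addOrderOf P = 2) ∨
      ((W.conductorNorm ℤ).Prime ∧ Even (W.LFunction 2) ∧ W.Δ < 0) ∨
      (W.HasCM ∧ W.conductorNorm ℤ ∈ ({27, 32, 49, 243} : Finset ℕ)))

/-- **Corollary used by cell `bsd-f2-manin` (the print floor at `2` on the `4 ∣ N` band):** under
Calegari–Emerton's theorem, an elliptic curve with `4 ∣ N`, no rational point of order `2` and without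
complex multiplication has EVEN modular degree (case (b) needs `N` prime, impossible when `4 ∣ N`).
[cite: CalegariEmerton2008, Theorem 1 (arXiv:math/0503359, p. 2)] -/
theorem calegariEmerton_oddModularDegree.even_modularDegree_of_four_dvd_conductor
    (h : calegariEmerton_oddModularDegree) (W : WeierstrassCurve ℚ) [W.IsElliptic]
    [NeZero (W.conductorNorm ℤ)] (D : ModularParametrizationData W (W.conductorNorm ℤ))
    (hmin : ∀ D' : ModularParametrizationData W (W.conductorNorm ℤ), D.modularDegree ≤ D'.modularDegree)
    (h4 : 4 ∣ W.conductorNorm ℤ) (htors : ∀ P : W.toAffine.Point, addOrderOf P ≠ 2) (hCM : ¬ W.HasCM) :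
    Even D.modularDegree := by
  by_contra hodd
  rw [Nat.not_even_iff_odd] at hodd
  obtain ⟨-, -, hP | ⟨hprime, -, -⟩ | ⟨hcm, -⟩⟩ := h W D hmin hodd
  · obtain ⟨P, hP⟩ := hP
    exact htors P hP
  · have h2 : 2 ∣ W.conductorNorm ℤ := dvd_trans (by norm_num) h4
    rcases (Nat.dvd_prime hprime).1 h2 with h | h
    · norm_num at h
    · rw [← h] at h4
      norm_num at h4
  · exact hCM hcm

end Literature.NumberTheory.EllipticCurves

end
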